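import Summits.ResolutionOfSingularities.ResolutionOfSingularities.Theorems.WeightedInvariantDatumToEmbeddedCentreHomogeneous
import HarnessLib

/-!
# `(hom)` from smooth invariance: ideal sheaves determined by `X` along smooth morphisms are homogeneous on torus charts

Route `ResolutionOfSingularities/WeightedInvariant`, door crux `HypersurfaceCentreConstruction`
(stmt-ResolutionOfSingularities-19897), helper #5 (summit-side, OURS). The ENGINE behind
`DatumToEmbedded.CentreHomogeneous.stub_centre_isHomogeneous` (functorial datum) and
`vanishingIdeal_singSet_isHomogeneous` (reduced non-regular locus), isolated as one reusable statement with no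
datum, no grading condition on the constants and no base field:

* `isHomogeneous_ideal_of_forall_comap_eq_of_smooth` — let `X`, `K` be ideal sheaves on a scheme `Y` such that
  `K` is DETERMINED BY `X` ALONG SMOOTH MORPHISMS: for every affine scheme `T` and every two smooth morphisms
  `g₁, g₂ : T → Y` with `g₁*X = g₂*X` one has `g₁*K = g₂*K`. Then on every affine open `W ⊆ Y` and for every
  `ℤʲ`-grading `𝒜` of `Γ(Y, W)` making `X(W)` homogeneous, `K(W)` is homogeneous. (Apply the hypothesis to the
  coaction and the projection `Spec Γ(Y, W)[ℤʲ] ⇉ Y` of the grading — both smooth, equal on `X` because `X(W)` is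
  homogeneous — and read the equality on the torus chart: `ρ(K(W))·L = K(W)·L` forces homogeneity,
  `isHomogeneous_of_map_coaction_le`.)
* `piece_isHomogeneous_of_forall_comap_eq_of_smooth` — the same for all pieces of a Rees algebra `R`, in the exact
  shape of the clause `(hom)` of `IsAdmissibleCentre f X R` / `HypersurfaceTerminatingCentreDatum.centre_isHomogeneous`
  (the unused degree-`0` condition on constants is accepted and discarded).

Intended consumer: sub-stub [S5] of the H2c″ assembly (res-D-brk-1-as-stub-9, 05:14:26Z): a global centre whose
stalks are built from `(𝒪_{Y,y}, X_y)` by a recipe compatible with essentially smooth local homomorphisms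
(clause (c11)) is determined by `X` along smooth morphisms, hence satisfies `(hom)` by this file — over finite
fields too (no `𝔾ₘ(k)`-points are used, only the coaction). AI-written; weaker than expert review.
References: J. Włodarczyk, arXiv:2203.03090, Thm. 1.1.4 (6) («functoriality … for group actions») [Wlodarczyk2022].
-/

noncomputable section

open CategoryTheory CategoryTheory.Limits AlgebraicGeometry TopologicalSpace
open Literature.AlgebraicGeometry.Resolution

set_option linter.dupNamespace false -- mandated namespace of this single-conjunct summit

namespace Summit.ResolutionOfSingularities.ResolutionOfSingularities.Theorems

open DatumToEmbedded.CentreHomogeneous AddMonoidAlgebra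

/-- **Smooth invariance relative to `X` implies homogeneity on the torus charts of `X`.** Let `X, K` be ideal
sheaves on a scheme `Y` with `K` determined by `X` along smooth morphisms from affine schemes (`g₁*X = g₂*X ⇒
g₁*K = g₂*K` for smooth `g₁, g₂ : T → Y`, `T` affine). Then for every affine open `W` and every `ℤʲ`-grading `𝒜`
of `Γ(Y, W)` with `X(W)` homogeneous, `K(W)` is homogeneous: the coaction `act = Spec ρ` and the projection
`pr = Spec ι₀` from the torus chart `T = Spec Γ(Y, W)[ℤʲ]` are smooth, `act*X = pr*X` as `X(W)` is homogeneous
(`map_coaction_eq_of_isHomogeneous`), so `act*K = pr*K`, i.e. `ρ(K(W)) L = K(W) L`, which is homogeneity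
(`isHomogeneous_of_map_coaction_le`). [cite: Wlodarczyk2022, Thm. 1.1.4 (6)] -/
theorem isHomogeneous_ideal_of_forall_comap_eq_of_smooth {Y : Scheme.{0}} (X K : Y.IdealSheafData)
    (hK : ∀ ⦃T : Scheme.{0}⦄ [IsAffine T] (g₁ g₂ : T ⟶ Y) [Smooth g₁] [Smooth g₂],
      X.comap g₁ = X.comap g₂ → K.comap g₁ = K.comap g₂)
    {j : ℕ} (W : Y.affineOpens) (𝒜 : (Fin j → ℤ) → AddSubgroup Γ(Y, W)) [GradedRing 𝒜]
    (hX : (X.ideal W).IsHomogeneous 𝒜) : (K.ideal W).IsHomogeneous 𝒜 := by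
  obtain ⟨ρ, hρ⟩ := exists_coaction 𝒜
  -- the torus chart `T = 𝔾ₘʲ × W` with its action and projection maps to `Y`
  let L : Type := (Γ(Y, W) : Type)[Fin j → ℤ]
  let T : Scheme.{0} := Spec (.of L)
  let φa : Γ(Y, W) ⟶ CommRingCat.of L := CommRingCat.ofHom ρ
  let φp : Γ(Y, W) ⟶ CommRingCat.of L := CommRingCat.ofHom singleZeroRingHom
  let act : T ⟶ Y := Spec.map φa ≫ W.2.fromSpec
  let pr : T ⟶ Y := Spec.map φp ≫ W.2.fromSpec
  haveI : Smooth (Spec.map φa) :=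
    (HasRingHomProperty.Spec_iff (P := @Smooth)).mpr (smooth_coaction 𝒜 ρ hρ)
  haveI : Smooth (Spec.map φp) :=
    (HasRingHomProperty.Spec_iff (P := @Smooth)).mpr (smooth_singleZeroRingHom _ j)
  haveI : Smooth act := inferInstance
  haveI : Smooth pr := inferInstance
  haveI : IsAffine T := inferInstanceAs (IsAffine (Spec (.of L)))
  -- `act` and `pr` pull `X` back to the same ideal sheaf (`X(W)` is homogeneous)
  have hcomapT : X.comap act = X.comap pr := by
    refine Scheme.IdealSheafData.ext_of_isAffine ?_
    simp only [act, pr]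
    rw [comap_SpecMap_fromSpec_ideal_top, comap_SpecMap_fromSpec_ideal_top]
    simp only [φa, φp, CommRingCat.hom_ofHom]
    rw [map_coaction_eq_of_isHomogeneous 𝒜 ρ hρ hX]
  -- hence so do they pull back `K`; read on the torus chart
  have hC := hK act pr hcomapT
  have hC' := congrArg (fun K : T.IdealSheafData => K.ideal ⟨⊤, isAffineOpen_top T⟩) hC
  simp only [act, pr] at hC'
  rw [comap_SpecMap_fromSpec_ideal_top, comap_SpecMap_fromSpec_ideal_top] at hC'
  simp only [φa, φp, CommRingCat.hom_ofHom] at hC'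
  exact isHomogeneous_of_map_coaction_le 𝒜 ρ hρ (ideal_map_iso_inv_injective _ hC').le

/-- **The clause `(hom)` of an admissible centre from smooth invariance.** If every piece of the Rees algebra `R`
on `Y` is determined by `X` along smooth morphisms from affine schemes, then `R` satisfies the clause `(hom)` of
`IsAdmissibleCentre f X R` (for any `f`; the degree-`0` condition on constants is not needed): on every affine
`W` with a `ℤʲ`-grading making `X(W)` homogeneous, all `Rₙ(W)` are homogeneous. [cite: Wlodarczyk2022, Thm. 1.1.4 (6)] -/
theorem piece_isHomogeneous_of_forall_comap_eq_of_smooth {k : Type} [Field k] {Y : Scheme.{0}}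
    (f : Y ⟶ Spec (.of k)) (X : Y.IdealSheafData) (R : ReesAlgebraData Y)
    (hR : ∀ ⦃T : Scheme.{0}⦄ [IsAffine T] (g₁ g₂ : T ⟶ Y) [Smooth g₁] [Smooth g₂],
      X.comap g₁ = X.comap g₂ → ∀ n : ℕ, (R.piece n).comap g₁ = (R.piece n).comap g₂) :
    ∀ (j : ℕ) (W : Y.affineOpens) (𝒜 : (Fin j → ℤ) → AddSubgroup Γ(Y, W)) [GradedRing 𝒜],
      (∀ c : Γ(Spec (.of k), ⊤), f.appLE ⊤ W le_top c ∈ 𝒜 0) → (X.ideal W).IsHomogeneous 𝒜 →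
      ∀ n : ℕ, ((R.piece n).ideal W).IsHomogeneous 𝒜 :=
  fun _ W 𝒜 _ _ hX n =>
    isHomogeneous_ideal_of_forall_comap_eq_of_smooth X (R.piece n)
      (fun _ _ g₁ g₂ _ _ h => hR g₁ g₂ h n) W 𝒜 hX

end Summit.ResolutionOfSingularities.ResolutionOfSingularities.Theorems

end
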